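import Summits.QuantumAdvantage.QuantumAdvantage.Theorems.CubicForrelationNearExactIsExactTwelveLevelSixOffFlatE

/-!
# Crux `CubicForrelation.NearExactIsExact` (stmt-QuantumAdvantage-14043) — n = 12, level ≥ 6 AT `Φ = 936/1024`: packaging the RIGID off-flat
  configurations (48 points of cost `≥ 4` exhaust the off-flat energy `192`)

Certificate seat `b2b-cforr-cert` (gen 18).  HONEST FRAMING: elementary bookkeeping (standard axioms) for the level-`≥ 6` branch of "is `936/1024`
attained at `n = 12`?"; NOT summit progress.

`tw18_rigid_pack`: if `48` or more points off `Z`, each of cost `e² ≥ 4`, lie in three given cosets, and the total off-flat energy is `≤ 192`,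
then the energy is exactly `192`, those points have `e² = 4`, every other point off `Z` has `e = 0`, and hence the set `Ω = {y ∉ Z : 8 ∤ e(y)}`
is contained in the three cosets, has at most `48` points, and `e² = 4` on it.  Used by `tw18_off_flat_le192` for the two new exceptional shapes at
off-flat energy `192` (three round-1 bad cosets of `16` points; a `32 + 16` pair).
-/

set_option linter.dupNamespace false -- D-0017: single-problem summit ⇒ `QuantumAdvantage.QuantumAdvantage` by design

noncomputable section

namespace Summit.QuantumAdvantage.QuantumAdvantage.Theorems.CubicForrelation.NearExactIsExact

open Finset

/-- **Rigid packaging.**  See the module docstring. [this work] -/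
theorem tw18_rigid_pack {α : Type*} [DecidableEq α] [Fintype α] (e : α → ℤ) (Z U C₁ C₂ C₃ : Finset α)
    (hUZ : ∀ x ∈ U, x ∉ Z) (hU4 : ∀ x ∈ U, 4 ≤ e x ^ 2) (hU48 : 48 ≤ #U) (hUC : ∀ x ∈ U, x ∈ C₁ ∨ x ∈ C₂ ∨ x ∈ C₃)
    (hoff_le : ∑ x ∈ univ.filter (fun x => x ∉ Z), e x ^ 2 ≤ 192) :
    (∀ ω ∈ univ.filter (fun ω => ω ∉ Z ∧ ¬ (8 : ℤ) ∣ e ω), ω ∈ C₁ ∨ ω ∈ C₂ ∨ ω ∈ C₃) ∧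
    #(univ.filter (fun ω => ω ∉ Z ∧ ¬ (8 : ℤ) ∣ e ω)) ≤ 48 ∧
    (∀ ω ∈ univ.filter (fun ω => ω ∉ Z ∧ ¬ (8 : ℤ) ∣ e ω), e ω ^ 2 = 4) ∧
    192 ≤ ∑ x ∈ univ.filter (fun x => x ∉ Z), e x ^ 2 := by
  classical
  have hUsub : U ⊆ univ.filter (fun x => x ∉ Z) := fun x hx => mem_filter.2 ⟨mem_univ _, hUZ x hx⟩
  have hUsum_ge : 4 * (#U : ℤ) ≤ ∑ x ∈ U, e x ^ 2 := by
    have h := sum_le_sum hU4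
    rw [sum_const, nsmul_eq_mul] at h
    linarith
  have hUle : ∑ x ∈ U, e x ^ 2 ≤ ∑ x ∈ univ.filter (fun x => x ∉ Z), e x ^ 2 :=
    sum_le_sum_of_subset_of_nonneg hUsub fun x _ _ => sq_nonneg _
  have hU48' : (48 : ℤ) ≤ #U := by exact_mod_cast hU48
  have hUcard : #U ≤ 48 := by
    have : (#U : ℤ) ≤ 48 := by linarith
    exact_mod_cast this
  have hUsum : ∑ x ∈ U, e x ^ 2 = 192 := by linarith
  have hoff : ∑ x ∈ univ.filter (fun x => x ∉ Z), e x ^ 2 = 192 := by linarith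
  -- `e² = 4` on `U`
  have hU4eq : ∀ x ∈ U, e x ^ 2 = 4 := by
    have hz : ∑ x ∈ U, (e x ^ 2 - 4) = 0 := by
      rw [sum_sub_distrib, sum_const, nsmul_eq_mul, hUsum]
      have : (#U : ℤ) = 48 := by linarith
      rw [this]; norm_num
    intro x hx
    have := (sum_eq_zero_iff_of_nonneg fun y hy => by linarith [hU4 y hy]).1 hz x hx
    linarith
  -- `e = 0` off `Z ∪ U`
  have hrest : ∀ x, x ∉ Z → x ∉ U → e x = 0 := by
    intro x hxZ hxU
    have hsplit := sum_filter_add_sum_filter_not (univ.filter fun x => x ∉ Z) (fun x => x ∈ U) (fun x => e x ^ 2)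
    have e1 : (univ.filter fun x : α => x ∉ Z).filter (fun x => x ∈ U) = U := by
      ext y; simp only [mem_filter, mem_univ, true_and]; exact ⟨fun h => h.2, fun h => ⟨hUZ y h, h⟩⟩
    rw [e1, hUsum, hoff] at hsplit
    have hzero : ∑ x ∈ (univ.filter fun x : α => x ∉ Z).filter (fun x => x ∉ U), e x ^ 2 = 0 := by linarith
    have hx : x ∈ (univ.filter fun x : α => x ∉ Z).filter (fun x => x ∉ U) :=
      mem_filter.2 ⟨mem_filter.2 ⟨mem_univ _, hxZ⟩, hxU⟩
    have := (sum_eq_zero_iff_of_nonneg fun y _ => sq_nonneg (e y)).1 hzero x hx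
    exact pow_eq_zero_iff (n := 2) (by norm_num) |>.1 this
  have hΩU : ∀ ω ∈ univ.filter (fun ω => ω ∉ Z ∧ ¬ (8 : ℤ) ∣ e ω), ω ∈ U := by
    intro ω hω
    obtain ⟨hωZ, hω8⟩ := (mem_filter.1 hω).2
    by_contra hωU
    exact hω8 (by rw [hrest ω hωZ hωU]; exact dvd_zero _)
  refine ⟨fun ω hω => hUC ω (hΩU ω hω), (card_le_card fun ω hω => hΩU ω hω).trans hUcard, fun ω hω => hU4eq ω (hΩU ω hω), ?_⟩
  rw [hoff]

end Summit.QuantumAdvantage.QuantumAdvantage.Theorems.CubicForrelation.NearExactIsExact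

end
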